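import Summits.QuantumFields.YangMills.Theorems.BalabanUVNodesN11RePinnedParamDefs
import Literature.MathematicalPhysics.QuantumFieldTheory.Balaban1983to89.Node00.Record13SepCoPHChi
import Literature.MathematicalPhysics.QuantumFieldTheory.Balaban1983to89.Node00.Record13ResidualsRChi
import Summits.QuantumFields.YangMills.Theorems.BalabanUVNodesN11HistoryPinnedResidualDefsChi

/-!
# χ-GENERIC RE-ISSUE (WORK ORDER RC-1 «RE-CENTRE THE RECORD», director-ym №462 (B) ∕ №467 (D)) of `BalabanUVNodesN11RePinnedParamDefs`

Cell `pub-ymgap` (HUMAN RULING D-0062, Track A), seat `pub-ymgap-dag-n11-d` (N11 [B14] s2; N11-σ campaign, `N11-G44-RC1-REACH-CENSUS.md`).  The CENTRE-TYPED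
declarations of `BalabanUVNodesN11RePinnedParamDefs` (those whose statement reads the (2.9) cut-off centre through `gOfRecord₁₃ ∕ EOfRecord₁₃ ∕ Provisos₁₃… ∕ T∕SLaw₁₃… ∕
UbgOfRecord₁₃… ∕ WtOfRecord₁₃… ∕ datum∕tower∕coreOfRecord₁₃…`) RE-ISSUED VERBATIM in the β-slot `χ : ChiSlot F N` over [Ax-3b]∕[Ax-3c]∕[Ax-3d]'s χ-generic carriers
(`Node00/Record13Chi` ∕ `Record13CoPHChi` ∕ `Record13SepCoPHChi`): σ = (binder `(χ : ChiSlot F N)` after `θ`; Node00 defs `X ↦ XChi … χ`; Node00 rows `Y ↦ Y_chi`;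
this lane's sibling modules `…Chi` for Summits-side dependencies); SAME short names in the sibling namespace `…BalabanUVNodesN11RePinnedParamDefsChi` (consumers switch by namespace);
the 17 centre-FREE declarations of the original are NOT copied — they are reused BY NAME (`open … (…)` below).  At `χ := chiβOfRecord₁₃ θ` every statement here is
DEFINITIONALLY the landed one ([Ax-3b]'s `rfl` receipts); at `χ := chiβOfRecord₁₃Ax θ` it is what the Ax-record's N11 machine reads.  Nothing of record edited (body-freeze №460 (2)).

HONEST FRAMING.  Count-neutral kernel re-elaboration of landed N11 bookkeeping∕estimates in a parameter; every HYPOTHESIS of the original stays a hypothesis; nothing of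
Bałaban asserted beyond what the original file proves; N11 NOT discharged; K-items untouched; counts unmoved.  One finite `𝕋⁴_{L^K}` programme at fixed `ε = L^{−K}` —
NOT ℝ⁴, NOT OS, NOT a mass gap, NOT Clay.  No `sorry`∕`instance`∕`notation`.  Sources: as the original module, plus [I] = [Balaban1987RG1] (2.9) p.266 (the cut-off's centre).
-/

noncomputable section

open MeasureTheory
open scoped BigOperators Matrix.Norms.L2Operator

namespace Summit.QuantumFields.YangMills.Theorems.BalabanUVNodesN11RePinnedParamDefsChi

open Summit.QuantumFields.YangMills.Theorems.BalabanUVNodesN11RePinnedParamDefs (rePinH_toStage13RParams rePinH_toStage13Params rePinH_Phih rePinH_Zh rePinH_Zh_levelFree rePinH_rePinH rzAt_rePinH admissible_rePinH_iff slotsNondegenerate₁₃_rePinH_iff provisos₁₃CoPH_rePinH provisos₁₃SepCoPH_rePinH antecedent_rePinH exists_rePinH_of_exists zhAt_rePinH_ζ0_zero_univ_pairCfg zhAt_rePinH_quad prefix_agree_rePinH zhAt_rePinH_seqAllLarge)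
open Literature.MathematicalPhysics.QuantumFieldTheory.Balaban1983to89 T4Continuum Node00 Node00.Tk
open B14.Eq218Concrete B15DeterminingSets
open BalabanUVNodesN11HistoryPinnedResidualDefs hiding IsNoExpHistAt ZhPinOfRecord₁₃ ZhPinOfRecord₁₃_quad ZhPinOfRecord₁₃_ζ0_empty_of_hist ZhPinOfRecord₁₃_ζ0_of_hist_of_ne_of_ne ZhPinOfRecord₁₃_ζ0_of_not ZhPinOfRecord₁₃_ζ0_seqAllLarge ZhPinOfRecord₁₃_ζ0_univ_of_hist finsum_ζ0_ZhPinOfRecord₁₃ histPinOfRecord₁₃ histPinOfRecord₁₃_le_one histPinOfRecord₁₃_local histPinOfRecord₁₃_nonneg histPinOfRecord₁₃_pairCfg histPinOfRecord₁₃_pairCfgAt histPinOfRecord₁₃_seqAllLarge isNoExpHistAt_restrict isNoExpHistAt_self laws_ZhPinOfRecord₁₃ localLaws_ZhPinOfRecord₁₃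
open BalabanUVNodesN11HistoryPinnedResidualDefsChi

variable {F : T4Family} {N : ℕ} [NeZero N]

/-! ## §4  ★★ The re-pinned v1.7 parameter `rePinH θ` and its faces -/

section RePin

variable (θ : Stage13HParams F N) (χ : ChiSlot F N)

/-- **★★ THE RE-PINNED v1.7 PARAMETER**: `θ` with its history-indexed residual 𝐓-weight slot REPLACED by the certificate family of §3 (read at the Stage-13 part of
`θ`; LEVEL-FREE in the step index `n`) — every other field (the Stage-13 part, the run-indexed `Zr`, the smearing functions `Phih`) UNCHANGED.  Every proviso ∕ guard of
the K⁷ texts transfers from `θ` to `rePinH θ` (below), and at `rePinH θ` this seat's binders (P) `hpre`, (V) `hZ`, `hq`, `hqloc` of the general-history no-expansion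
𝐓-step hold at EVERY no-expansion history (faces below; consumers in `…N11NoExpansionGeneralStepRePinned`). [cite: Balaban1988Convergent, p.257, (2.20)–(2.22) p.258, (3.16)–(3.20) pp.268–269; Balaban1989LargeFieldI, (0.2)–(0.3) p.176] -/
def rePinH : Stage13HParams F N :=
  ⟨θ.toStage13RParams, fun p _ Ω Λ => ZhPinOfRecord₁₃ θ.toStage13Params χ p Ω Λ, θ.Phih⟩

/-- The residual serving the history `s` at the re-pinned parameter (`rfl`). [cite: Balaban1988Convergent, (3.16)–(3.20) pp.268–269 (bookkeeping)] -/
theorem zhAt_rePinH (p : B12.RunParams) {n : ℕ} (s : SeqOfRecord F θ.ν θ.τ9.M (gOfRecord₁₃Chi F N θ.toStage13Params χ p) p.K n) :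
    (rePinH θ χ).zhAtChi χ p s = ZhPinOfRecord₁₃ θ.toStage13Params χ p s.Ω s.Λ := rfl

variable {θ χ}

/-- **★ PRINT'S PARTITION OF UNITY HOLDS AT THE RE-PINNED PARAMETER** (the guard `ZhUnity` of the K⁷ texts), unconditionally. [cite: Balaban1988Convergent, (3.16)–(3.20) pp.268–269] -/
theorem zhUnity_rePinH : (rePinH θ χ).ZhUnity F N :=
  fun p _ Ω Λ j ω => finsum_ζ0_ZhPinOfRecord₁₃ (θ := θ.toStage13Params) (χ := χ) (p := p) Ω Λ j ω

/-! ### The pin faces at the re-pinned parameter: this seat's binders (P), (V), `hq`, `hqloc` at EVERY no-expansion history -/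

variable (θ) (p : B12.RunParams)

/-- **(V) `hZ` AT EVERY NO-EXPANSION HISTORY**: at `s′` of length `k+1` with `Ω_{k+1}(s′) = ∅`, `k < K`, the generation-`k` factor `ζ0_k(T)` of the residual serving `s′`
at g3's two-scale configuration IS `χ_k(Ω_k(init s′))(U₀) · w_k(s′)(U₀, Ū₀)` — LITERALLY the binder of p544575 `clause_succ_CoPH_of_Omega_empty_of_pinChi_of_clause`.
[cite: Balaban1988Convergent, (2.21) p.258, (3.16) p.268, (3.24)–(3.25) p.270] -/
theorem zhAt_rePinH_ζ0_univ_pairCfgAt {k : ℕ} (hk : k < p.K) (s : SeqOfRecord F θ.ν θ.τ9.M (gOfRecord₁₃Chi F N θ.toStage13Params χ p) p.K (k + 1))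
    (hΩ : s.Ω (k + 1) = ∅) (V' : GaugeField (F.P p.K) (k + 1) (SU N)) (U₀ : GaugeField (F.P p.K) k (SU N)) :
    ((rePinH θ χ).zhAtChi χ p s).ζ0 k Set.univ (pairCfgAt (V := FluctV N) k V' U₀) =
      chiSeqOfRecord F N θ.ν θ.τ9.M (gOfRecord₁₃Chi F N θ.toStage13Params χ p) p.K k s.init U₀ *
        wOfRecord₉ F N θ.toStage9Params p (gOfRecord₁₃Chi F N θ.toStage13Params χ p) k s U₀ ((avOfRecord F N p.K k).avg U₀) := by
  rw [zhAt_rePinH, ZhPinOfRecord₁₃_ζ0_univ_of_hist hk (isNoExpHistAt_self (θ := θ.toStage13Params) (χ := χ) (p := p) s hΩ), histPinOfRecord₁₃_pairCfgAt]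

/-- **(P) `hpre` AT EVERY NO-EXPANSION STEP**: at `s′` with `Ω_{k+1}(s′) = ∅` the residual serving `s′` IS the residual serving `init s′` (the slot is level-free and
`init s′`, `s′` have the same raw set-sequences). [cite: Balaban1988Convergent, (2.1) p.254, p.257, (2.20)–(2.22) p.258] -/
theorem zhAt_rePinH_eq_init_of_Omega_empty {k : ℕ} (s : SeqOfRecord F θ.ν θ.τ9.M (gOfRecord₁₃Chi F N θ.toStage13Params χ p) p.K (k + 1)) (hΩ : s.Ω (k + 1) = ∅) :
    (rePinH θ χ).zhAtChi χ p s = (rePinH θ χ).zhAtChi χ p s.init := by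
  have hΛ : s.Λ (k + 1) = ∅ := Set.subset_eq_empty (s.chain.Λ_subset (k + 1) (Nat.succ_pos k) le_rfl) hΩ
  have hΩf : s.init.Ω = s.Ω := by
    funext j
    rcases Nat.lt_or_ge k j with hj | hj
    · rw [s.init.Ω_off j (fun h => absurd h.2 (not_le.mpr hj))]
      rcases Nat.lt_or_ge (k + 1) j with hj' | hj'
      · exact (s.Ω_off j (fun h => absurd h.2 (not_le.mpr hj'))).symm
      · obtain rfl : j = k + 1 := le_antisymm hj' hj
        exact hΩ.symm
    · exact seq_init_Ω_of_le s hj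
  have hΛf : s.init.Λ = s.Λ := by
    funext j
    rcases Nat.lt_or_ge k j with hj | hj
    · rw [s.init.Λ_off j (fun h => absurd h.2 (not_le.mpr hj))]
      rcases Nat.lt_or_ge (k + 1) j with hj' | hj'
      · exact (s.Λ_off j (fun h => absurd h.2 (not_le.mpr hj'))).symm
      · obtain rfl : j = k + 1 := le_antisymm hj' hj
        exact hΛ.symm
    · exact seq_init_Λ_of_le s hj
  rw [zhAt_rePinH, zhAt_rePinH, hΩf, hΛf]

end RePin

end Summit.QuantumFields.YangMills.Theorems.BalabanUVNodesN11RePinnedParamDefsChi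

end
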